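import Summits.Ventures.AbcSig.Rows.TemplateC2a
import Summits.Ventures.AbcSig.Levels.N622
import Summits.Ventures.AbcSig.Levels.N9952
import Summits.Ventures.AbcSig.Rows.C2aL311A0

/-!
# Venture AbcSig — ROW `C2aL311A0AB`: `311^m·xⁿ + yⁿ = z²` (SECOND coefficient distribution `(A, B) = (311^m, 2^0)` of the
cell; the distribution `xⁿ + 311^m·yⁿ = z²` is `Rows/C2aL311A0.lean`), class `a = 0` (GENERATED by p-lean gen/make_rows.py)

HONEST FRAMING. A row of a COMPUTATION cell (`pub-abcsig`); a CONDITIONAL theorem, no claim on ABC or any summit.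
For `a = 0` the second distribution is the first with the variables swapped (`IsPrimitiveSolution.swap`), so this
file is a corollary of `row_C2aL311A0` with the SAME hypotheses (`BS04Package` CITED, `DataComplete …` COMPUTED, the
row's per-orbit exclusions `hX_…` CITED, stated for the family predicate `famB (2 ^ 0 * 311 ^ m) …` of the first row).
-/

namespace Summit.Ventures.AbcSig

/-- Row `C2aL311A0AB`: second coefficient distribution `311^m·xⁿ + 2^0·yⁿ = z²` (see module docstring). -/
theorem row_C2aL311A0AB (M : NewformModel) (hP : M.BS04Package)
    (hD622 : M.DataComplete 622 level622Orbits) (hD9952 : M.DataComplete 9952 level9952Orbits)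
    (n : ℕ) (hn : n.Prime) (hmin : 11 ≤ n) (hnℓ : n ≠ 311) (m : ℕ) (hm : 1 ≤ m) (hmn : m < n)
    (hX_orbit_622_4 : n ∈ ([13] : List ℕ) → M.Excludes 622 orbit_622_4 (famB (2 ^ 0 * 311 ^ m) n (fun _ _ => True)))
    (hX_orbit_9952_1 : n ∈ ([7, 11] : List ℕ) → M.Excludes 9952 orbit_9952_1 (famB (2 ^ 0 * 311 ^ m) n (fun _ _ => True)))
    (hX_orbit_9952_2 : n ∈ ([7, 11] : List ℕ) → M.Excludes 9952 orbit_9952_2 (famB (2 ^ 0 * 311 ^ m) n (fun _ _ => True)))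
    (hX_orbit_9952_9 : n ∈ ([13] : List ℕ) → M.Excludes 9952 orbit_9952_9 (famB (2 ^ 0 * 311 ^ m) n (fun _ _ => True)))
    (hX_orbit_9952_10 : n ∈ ([13] : List ℕ) → M.Excludes 9952 orbit_9952_10 (famB (2 ^ 0 * 311 ^ m) n (fun _ _ => True)))
    (x y z : ℤ) (hxy1 : x * y ≠ 1) (hxy2 : x * y ≠ -1) : ¬ IsPrimitiveSolution (311 ^ m) (2 ^ 0) 1 n x y z := by
  intro h
  have h' : IsPrimitiveSolution 1 (2 ^ 0 * 311 ^ m) 1 n y x z := by simpa only [pow_zero, one_mul] using h.swap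
  exact row_C2aL311A0 M hP hD622 hD9952 n hn hmin hnℓ m hm hmn hX_orbit_622_4 hX_orbit_9952_1 hX_orbit_9952_2 hX_orbit_9952_9 hX_orbit_9952_10 y x z (by rwa [mul_comm]) (by rwa [mul_comm]) h'

end Summit.Ventures.AbcSig
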